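import Summits.Ventures.QEC.Census.CertBZWords
import Summits.Ventures.QEC.Census.CertLogical
import Summits.Ventures.QEC.Census.CertParity
import Summits.Ventures.QEC.Census.CertControls
import HarnessLib

/-!
# The Brouwer–Zimmermann branch of the CSS distance-certificate checker: data and Boolean replay
# (plan/CERT-FORMAT.md v1.1 §5.3 method `bz` (+ L7 parity); census/search-1/BZ-CHECKER-SPEC.md §D, §C1–C5)

The brute-force / meet-in-the-middle replays (`Census/CertCheck.lean`, `Census/CertCheckMitm.lean`) visit every
support of weight `≤ wmax`; for distances `d ≥ 10` (`[[90,8,10]]`, `[[108,8,10]]`, `[[144,12,12]]`) that is out of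
reach. Kernel A's method `bz` (Brouwer–Zimmermann with Zimmermann's relative ranks) replaces it by: per side, a
LOGICAL BASIS `L` with duals `Ld` (CERT-FORMAT `logicals`), the RANK CERTIFICATES (`k_cert`, type-02's
`RankCert`), and BLOCKS — each block `b` a list `W_b` of label combinations and a block code
`C_b = span (G_b)`, `G_b := (pivot rows of Hstab) ++ (⊕_{i∈w} L_i for w ∈ W_b)`, with MATRICES `G_i := A_i · G_b`
systematic on column lists `T_i`, enumeration depths `t_i`, such that the relative-rank bound
`Σ_i (t_i + 1 − (kb − r_i))⁺` exceeds the (parity-adjusted) `wmax`; the replay enumerates every `u · G_i` with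
`1 ≤ |u| ≤ t_i` and demands: weight `> wmax`, or allow-listed (an explicit stabilizer). A label COVER check
(every nonzero label lies in some `span W_b`) closes the argument.

This file is the DATA (`BZMatrix`, `BZBlock`, `BZSide`, `BZData`) and the Bool CHECKS, all structural
`List`/`Nat` recursion (`decide` / `native_decide`):
* C3 `systematicOK`, `bzBoundList` (relative ranks recounted on masks), C4 `matrixOK` (replay = `scan` of
  `Census/CertScan.lean` over the ROWS of `G_i`, leaf `bzLeaf` = `u = 0 ∨ wtGt wmax c ∨ c ∈ ALLOW`), `blockOK`;
* C5 `subsetXors` / `coverMask` / `coverOK`;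
* per side `bzStructOK` (O3 rank certificates via type-02's `RankCert.check`, O4 pairing via `logOK` of
  `Census/CertLogical.lean`, `n = r_syn + r_stab + k`, word sizes, optional C2 parity via type-06's `parityOK`,
  cover) and `bzBlockOK` (one block: C3 + C4), assembled as `DistCert.bzZ` / `DistCert.bzX` next to a `DistCert`
  whose `checkStructure` (O2, O5, C1 allow-lists) is unchanged.
SOUNDNESS (`(c.code _).dZ = c.dZ` from `checkStructure` + `bzZ`, per-block chunked) is the sibling file
`Census/CertCheckBZSound.lean`, which discharges the hypotheses of type-07's `Census/BZAssembly.lean`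
(`bz_block`, `bz_cover_of_blocks`) and `Coding/BrouwerZimmermannBound.lean` (L5) from these checks.
Automorphisms (`bz_aut`, L6) are a further sibling. No distance value is asserted here.
-/

namespace Summit.Ventures.QEC.Census

open Matrix Literature.InformationTheory.QuantumCodes

/-! ## Data (BZ-CHECKER-SPEC §D; JSON `lower.<side>.params` of CERT-FORMAT §5.3) -/

/-- One enumeration matrix of a block: `T` = the `kb` information-set columns, ordered (row `j` of `G_i` has its
pivot at `T[j]`); `A` = `kb` selection words over the rows of `G_b` (row `j` of `G_i` = `xorSel G_b A[j]`);
`t` = enumeration depth (a JSON depth `−1` is emitted as `0`: it enumerates nothing and only weakens nothing). -/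
structure BZMatrix where
  /-- information set: `kb` column indices, ordered by pivot row -/
  T : List ℕ
  /-- `kb` selection words over the rows of the block matrix `G_b` -/
  A : List ℕ
  /-- enumeration depth `t ≥ 0` -/
  t : ℕ

/-- One block: `W` = label words (each a subset of the `k` logicals; the block's extra generators are
`⊕_{i ∈ w} L_i`), `mats` = its enumeration matrices. -/
structure BZBlock where
  /-- label words `w` (bit `i` = logical `i`) -/
  W : List ℕ
  /-- the enumeration matrices of the block -/
  mats : List BZMatrix

/-- One side of a `bz` certificate: optional parity witness (rows of the syndrome matrix XOR-ing to the all-ones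
word, CERT-FORMAT L7 / `even_witness`) and the blocks. -/
structure BZSide where
  /-- `some sel`: `⊕_{i∈sel} Hsyn[i] = 𝟙`, so every kernel vector has even weight (`wmax_eff = wmax − wmax % 2`) -/
  evenWitness : Option (List ℕ)
  /-- the blocks -/
  blocks : List BZBlock

/-- The `bz` data accompanying a `DistCert` (CERT-FORMAT §3 `k_cert` + `logicals` + §5.3 `params` of both sides):
rank certificates of `H^X` and `H^Z`, the paired logical bases `LX`, `LZ` (words over the qubits), the two sides. -/
structure BZData where
  /-- rank certificate of `H^X` -/
  rcX : RankCert
  /-- rank certificate of `H^Z` -/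
  rcZ : RankCert
  /-- `X`-type logical basis (`k` words) -/
  LX : List ℕ
  /-- `Z`-type logical basis (`k` words) -/
  LZ : List ℕ
  /-- `Z` side (syndromes `H^X`, stabilizers `H^Z`, generators `LZ`, labels by `LX`) -/
  sideZ : BZSide
  /-- `X` side (roles exchanged) -/
  sideX : BZSide

/-! ## C3/C4: matrices and blocks -/

/-- The word with the listed bits set: `maskOf T = Σ_{q ∈ T} 2^q` (as an OR-fold, duplicates harmless). -/
def maskOf : List ℕ → ℕ
  | [] => 0
  | q :: qs => 2 ^ q ||| maskOf qs

/-- C3, systematic form: `|G| = |T|`, every `T[j'] < n`, and row `j` of `G` has bit `T[j']` set iff `j = j'`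
(this forces the `T[j']` to be distinct). (definition) -/
def systematicOK (n : ℕ) (G T : List ℕ) : Bool :=
  (G.length == T.length) && (T.all fun q => decide (q < n)) &&
    (List.range T.length).all fun j => (List.range T.length).all fun j' =>
      (G.getD j 0).testBit (T.getD j' 0) == decide (j = j')

/-- The leaf test of the `bz` enumeration at (selection word `u`, codeword `c`): the empty selection, or weight
`> wmax` (fast test `wtGt`), or an allow-listed word. (definition) -/
def bzLeaf (wmax : ℕ) (allow : List ℕ) (u c : ℕ) : Bool := (u == 0) || wtGt wmax c || allow.elem c

/-- The rows of the block matrix `G_b`: the pivot rows of `Hstab` named by the rank certificate, then the block's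
logical combinations `xorSel L w`, `w ∈ W`. (definition) -/
def gbRows (Hstab : List ℕ) (rcS : RankCert) (L : List ℕ) (b : BZBlock) : List ℕ :=
  (rcS.pivots.map fun p => Hstab.getD p 0) ++ b.W.map (xorSel L)

/-- The rows of `G_i = A_i · G_b`. (definition) -/
def giRows (Gb : List ℕ) (mt : BZMatrix) : List ℕ := mt.A.map (xorSel Gb)

/-- C3 + C4 for one matrix: `G_i` systematic on `T_i`, its rows words below `2^n`, and the REPLAY — the `scan` of
budget `t_i` over the rows of `G_i` (positions `(2^j, G_i[j])`) with leaf `bzLeaf`: every `u · G_i` with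
`1 ≤ |u| ≤ t_i` has weight `> wmax` or is allow-listed. (definition) -/
def matrixOK (n wmax : ℕ) (allow Gb : List ℕ) (mt : BZMatrix) : Bool :=
  systematicOK n (giRows Gb mt) mt.T && ((giRows Gb mt).all fun g => decide (g < 2 ^ n)) &&
    scan (bzLeaf wmax allow) (rowPos (giRows Gb mt) 0) mt.t 0 0

/-- The relative-rank bound of a list of matrices, `Σ_i (t_i + 1 − (kb − r_i))` with truncated subtraction and
`r_i` = the number of columns of `T_i` in no earlier `T_l` — RECOUNTED on masks (`U` = columns seen so far).
(definition) -/
def bzBoundList (n kb : ℕ) : List BZMatrix → ℕ → ℕ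
  | [], _ => 0
  | mt :: mts, U =>
    (mt.t + 1 - (kb - popc n (maskOf mt.T ^^^ (maskOf mt.T &&& U)))) + bzBoundList n kb mts (U ||| maskOf mt.T)

/-- C3 + C4 for one block: all its matrices check and its recounted bound reaches `target`. (definition) -/
def blockOK (n wmax target : ℕ) (allow Gb : List ℕ) (b : BZBlock) : Bool :=
  (b.mats.all fun mt => matrixOK n wmax allow Gb mt) && decide (target ≤ bzBoundList n Gb.length b.mats 0)

/-! ## C5: the label cover -/

/-- All XOR-combinations of a list of label words (`2^{|W|}` words, with repetitions if dependent). (definition) -/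
def subsetXors : List ℕ → List ℕ
  | [] => [0]
  | w :: ws => subsetXors ws ++ (subsetXors ws).map fun x => x ^^^ w

/-- The cover bitmap: bit `λ` is set iff the label word `λ` is a XOR-combination of some block's `W`. (definition) -/
def coverMask : List BZBlock → ℕ
  | [] => 0
  | b :: bs => maskOf (subsetXors b.W) ||| coverMask bs

/-- C5 (method `bz`): every nonzero label word `λ < 2^k` is covered. (definition) -/
def coverOK (k : ℕ) (blocks : List BZBlock) : Bool :=
  (List.range (2 ^ k)).all fun lam => (lam == 0) || (coverMask blocks).testBit lam

/-! ## Per side: structural part and block chunks -/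

/-- The parity-adjusted threshold: with an even-weight witness, `wmax − wmax % 2`; else `wmax`. (definition) -/
def wEff (wmax : ℕ) (ew : Option (List ℕ)) : ℕ :=
  match ew with
  | none => wmax
  | some _ => wmax - wmax % 2

/-- C2: the optional parity witness checks (`⊕ Hsyn[sel] = 𝟙`, type-06's `parityOK`). (definition) -/
def parityPartOK (n : ℕ) (Hsyn : List ℕ) (ew : Option (List ℕ)) : Bool :=
  match ew with
  | none => true
  | some sel => parityOK n Hsyn sel

/-- The STRUCTURAL part of a side's `bz` check (cheap; everything except the block replays): O3 the two rank
certificates (type-02's `RankCert.check`), O4 the pairing `logOK`, the dimension identity `n = r_syn + r_stab + k`,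
all logical words below `2^n`, C2 parity, C5 cover. (definition) -/
def bzStructOK (n : ℕ) (Hsyn Hstab : List ℕ) (rcY rcS : RankCert) (L Ld : List ℕ) (s : BZSide) : Bool :=
  rcY.check n Hsyn && rcS.check n Hstab && logOK n Hsyn Hstab L Ld && (n == rcY.r + rcS.r + L.length) &&
    (L.all fun l => decide (l < 2 ^ n)) && (Hstab.all fun h => decide (h < 2 ^ n)) &&
    parityPartOK n Hsyn s.evenWitness && coverOK L.length s.blocks

/-- Block chunk `b` of a side (C3 + C4 for block `b`, target `wEff + 1`); `true` past the end. (definition) -/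
def bzBlockOK (n : ℕ) (Hstab : List ℕ) (rcS : RankCert) (L : List ℕ) (wmax : ℕ) (allow : List ℕ) (s : BZSide)
    (b : ℕ) : Bool :=
  match s.blocks[b]? with
  | none => true
  | some blk => blockOK n wmax (wEff wmax s.evenWitness + 1) allow (gbRows Hstab rcS L blk) blk

/-- A whole side: structural part and every block. (definition) -/
def bzSideOK (n : ℕ) (Hsyn Hstab : List ℕ) (rcY rcS : RankCert) (L Ld : List ℕ) (wmax : ℕ) (allow : List ℕ)
    (s : BZSide) : Bool :=
  bzStructOK n Hsyn Hstab rcY rcS L Ld s &&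
    (List.range s.blocks.length).all fun b => bzBlockOK n Hstab rcS L wmax allow s b

namespace DistCert

/-- `Z` side, structural part: syndromes `HX` (rank cert `rcX`), stabilizers `HZ` (`rcZ`), generators `LZ`,
labels by `LX`. -/
def bzZStruct (c : DistCert) (z : BZData) : Bool := bzStructOK c.n c.HX c.HZ z.rcX z.rcZ z.LZ z.LX z.sideZ

/-- `Z` side, block chunk `b` (`wmax = dZ − 1`, allow-list of `sideZ`). -/
def bzZBlock (c : DistCert) (z : BZData) (b : ℕ) : Bool :=
  bzBlockOK c.n c.HZ z.rcZ z.LZ (c.dZ - 1) (c.sideZ.found.map Prod.fst) z.sideZ b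

/-- `Z` side, monolithic. -/
def bzZ (c : DistCert) (z : BZData) : Bool :=
  bzSideOK c.n c.HX c.HZ z.rcX z.rcZ z.LZ z.LX (c.dZ - 1) (c.sideZ.found.map Prod.fst) z.sideZ

/-- `X` side, structural part (roles exchanged: syndromes `HZ`, stabilizers `HX`, generators `LX`, labels `LZ`). -/
def bzXStruct (c : DistCert) (z : BZData) : Bool := bzStructOK c.n c.HZ c.HX z.rcZ z.rcX z.LX z.LZ z.sideX

/-- `X` side, block chunk `b`. -/
def bzXBlock (c : DistCert) (z : BZData) (b : ℕ) : Bool :=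
  bzBlockOK c.n c.HX z.rcX z.LX (c.dX - 1) (c.sideX.found.map Prod.fst) z.sideX b

/-- `X` side, monolithic. -/
def bzX (c : DistCert) (z : BZData) : Bool :=
  bzSideOK c.n c.HZ c.HX z.rcZ z.rcX z.LX z.LZ (c.dX - 1) (c.sideX.found.map Prod.fst) z.sideX

end DistCert

/-! ## Control: the Steane code's `bz` certificate (cert/examples/steane7-bz.certA.json, kernel A) -/

/-- Rank certificate of the Steane checks (both sides): pivots `0,1,2`, right inverses `{0},{1},{3}`. -/
def rcSteane : RankCert := { r := 3, pivots := [0, 1, 2], rinv := [1, 2, 8], dependent := [] }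

/-- The `bz` data of cert/examples/steane7-bz.certA.json (kernel A; transcribed by tools/bz2lean.py): `LX = LZ =
[{0,1,2}]`; per side one block with `W = [{0}]` (`kb = 4`: three pivot rows + one logical), two matrices given by
their information sets `T` and selection words `A` over the four `G_b` rows, depths `1`, bound `2 + 1 = 3`. -/
def bzSteane : BZData where
  rcX := rcSteane
  rcZ := rcSteane
  LX := [7]
  LZ := [7]
  sideZ :=
    { evenWitness := none,
      blocks := [{ W := [1],
                   mats := [{ T := [6, 2, 0, 3], A := [9, 11, 3, 13], t := 1 },
                            { T := [5, 4, 1, 6], A := [5, 14, 8, 15], t := 1 }] }] }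
  sideX :=
    { evenWitness := none,
      blocks := [{ W := [1],
                   mats := [{ T := [3, 2, 1, 6], A := [14, 11, 3, 10], t := 1 },
                            { T := [0, 5, 4, 3], A := [8, 2, 9, 15], t := 1 }] }] }

/-- The `bz` replay accepts the Steane certificate, `Z` side (`decide`, 8 codeword visits). -/
theorem bzZ_certSteane7 : certSteane7.bzZ bzSteane = true := by decide

/-- … and `X` side. -/
theorem bzX_certSteane7 : certSteane7.bzX bzSteane = true := by decide

/-! ## Row-count check (appended 2026-08-26): every matrix has `kb = |G_b|` rows

The relative-rank bound (lemma L5) needs every `G_i` to GENERATE the block code `span G_b`: `kb` systematic — hence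
independent — rows in `span G_b` do, fewer do not. `matrixOK` checks `|G_i| = |T_i|`; this check adds
`|A_i| = |G_b|` (so `|G_i| = |T_i| = kb`). The soundness theorem (`Census/CertCheckBZSound.lean`) takes it as a
separate cheap hypothesis (`decide`). -/

/-- Every matrix of every block of a side has as many rows as the block matrix `G_b` (`|A_i| = |G_b| = kb`).
(definition) -/
def bzLenOK (Hstab : List ℕ) (rcS : RankCert) (L : List ℕ) (s : BZSide) : Bool :=
  s.blocks.all fun blk => blk.mats.all fun mt => mt.A.length == (gbRows Hstab rcS L blk).length

namespace DistCert

/-- `Z` side row-count check (`kb = |G_b|` for every matrix). -/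
def bzZLen (c : DistCert) (z : BZData) : Bool := bzLenOK c.HZ z.rcZ z.LZ z.sideZ

/-- `X` side row-count check. -/
def bzXLen (c : DistCert) (z : BZData) : Bool := bzLenOK c.HX z.rcX z.LX z.sideX

end DistCert

/-- The Steane `bz` certificate passes the row-count checks. -/
theorem bzLen_certSteane7 : certSteane7.bzZLen bzSteane = true ∧ certSteane7.bzXLen bzSteane = true := by decide

end Summit.Ventures.QEC.Census
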